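import Literature.NumberTheory.Automorphic.UnitaryGroupHyperbolicTruncatedTraceClassTorusTwo
import Literature.NumberTheory.Automorphic.UnitaryGroupHyperbolicOrbitCompactSupportTwo
import Literature.NumberTheory.Automorphic.UnitaryGroupTruncatedKernelClassCuspVanishingTwo
import Literature.NumberTheory.Automorphic.AdelicUnitaryGroupUnimodularQuasiSplit
import Literature.NumberTheory.Automorphic.GLnIwasawaIntegration
import HarnessLib

/-!
# The hyperbolic term of the coarse geometric expansion for the quasi-split `U(J₂)` of a CM field: Rogawski's (6.1.3) (`H`-side copy)
(Rogawski, *Automorphic Representations of Unitary Groups in Three Variables* (1990), §6.1 pp. 79–80; §7.3 pp. 97–98, (6.1.1)–(6.1.3);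
Arthur, *A trace formula for reductive groups I*, Duke Math. J. 45 (1978), §8.)

The assembly of the regular hyperbolic row at the CM pair `(L⁺, L, complexConj)`: for `a, b ∈ Lˣ` with `c a · a ≠ 1`,
`c b · b = 1`, the refined class `i♯ = (((X − a)(X − b)(X − (c a)⁻¹)) ⊗ 𝔸_L, true)` of the Borel-refined
characteristic-polynomial class map `cl♭`, a TEST function `f` (★ `IsQuasiSplitTest`), an automorphic measure `μ`,
Haar measures `ν_G` of `G(𝔸)`, `ρ` of `T(𝔸)`, `ν` of `N(𝔸)` and a fundamental domain `𝓕` of `N(F)` in `N(𝔸)`: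

  `J^T_{i♯}(f) = c_μ · C_w · ∫_{G(𝔸) ⧸ T(𝔸)} f(x̃ γ♯ x̃⁻¹)·(2 log T − log H(x̃⁻¹) − log H(w x̃⁻¹)) d(ν_G/ρ)(x)`  for all `T ≫ 1`,

`γ♯ = d(a, b, (c a)⁻¹) ⊗ 1`, `c_μ` the unfolding constant of LAW 4 and `C_w ≠ ∞` THE rank-one window constant of
`ρ` (one constant serving every covering weight of `T(F)`, ★ `exists_rankOneInterval_forall_weight` — its defining
window law is carried as a conjunct). Composition of ★ STEP 3 `truncatedTraceClass_borelRefine_hyperbolic_eq_mul_mul_integral_quotient_sub_integral`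
with: the section of the fibre (★ `exists_section_borelRefine_hyperbolic`); a covering weight of `Z_{G(F)}(γ♯)` (★
`exists_isCoveringWeight_subgroup_map`); the window constant (★ `exists_torusFibre_unfolding`); unimodularity of `G(𝔸)` (★ `isMulRightInvariant_quasiSplit_cm_three`,
★ `isInvInvariant_of_isMulRightInvariant`); the finiteness of the weighted orbital majorant on `G(𝔸) ⧸ T(𝔸)` — compact
support of the orbit of the regular `γ♯` modulo `T(𝔸)` (★ `lintegral_enorm_conj_out_mul_arthurWeight_lt_top_hyperbolic`);
and the CUSP REMAINDER STEP `∫_X R_T dμ = 0` for `T ≫ 1` (★ `integral_quotFun_pseudoEisenstein_indicator_eq_zero_cm`),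
valid because the class `i♯` is `N`-regular on `B(F)` (★ `forall_diagUnit_ne_of_borelRefine_eq_hyperbolic`). NO
hypothesis beyond the letters. Two forms: `…_of_window` takes the window constant `C_w` of `ρ` as INPUT (one constant then
serves every hyperbolic class), `…_cm` packages its existence (★ `exists_torusFibre_unfolding`).

Theorems only; no definitions, no instances, no notation.
-/

open MeasureTheory Measure NumberField IsDedekindDomain Set Matrix Polynomial
open Literature.MeasureTheory.Group
open scoped NNReal ENNReal Classical MatrixGroups

namespace Literature.NumberTheory.Automorphic

namespace UnitaryGroup

/-! ## §1 Rogawski's (6.1.3) for the quasi-split `U(J₃)` of a CM field -/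

section CM

/-- **ROGAWSKI'S (6.1.3) AT FINITE `T`, THE WINDOW CONSTANT AS INPUT**: for every `C_w ≠ ∞` satisfying the rank-one window
law of `ρ` (`hwin`; such a constant exists and is unique, ★ `exists_rankOneInterval_forall_weight` — this form lets a
consumer use ONE `C_w` for all hyperbolic classes at once), there is `T₀` with
`J^T_{i♯}(f) = c_μ · C_w · ∫_{G(𝔸) ⧸ T(𝔸)} f(x̃ γ♯ x̃⁻¹)·(2 log T − log H(x̃⁻¹) − log H(w x̃⁻¹)) d(ν_G/ρ)(x)` for all `T > T₀`.
[cite: Rogawski1990, §6.1 (6.1.1)–(6.1.3)] [cite: Arthur1978TraceFormulaI, §8] -/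
theorem truncatedTraceClass_borelRefine_hyperbolic_cm_of_window_two (L : Type) [Field L] [NumberField L] [IsCMField L]
    [MeasurableSpace (adelicUnipotent (↥(maximalRealSubfield L)) L (IsCMField.complexConj L) 2)]
    [BorelSpace (adelicUnipotent (↥(maximalRealSubfield L)) L (IsCMField.complexConj L) 2)]
    [MeasurableSpace (quasiSplit (↥(maximalRealSubfield L)) L (IsCMField.complexConj L) 2).Adelic]
    [BorelSpace (quasiSplit (↥(maximalRealSubfield L)) L (IsCMField.complexConj L) 2).Adelic]
    [MeasurableSpace ((quasiSplit (↥(maximalRealSubfield L)) L (IsCMField.complexConj L) 2).Adelic ⧸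
      torusAdelic (↥(maximalRealSubfield L)) L (IsCMField.complexConj L) 2)]
    [BorelSpace ((quasiSplit (↥(maximalRealSubfield L)) L (IsCMField.complexConj L) 2).Adelic ⧸
      torusAdelic (↥(maximalRealSubfield L)) L (IsCMField.complexConj L) 2)]
    (μ : Measure (quasiSplit (↥(maximalRealSubfield L)) L (IsCMField.complexConj L) 2).automorphicQuotient)
    [(quasiSplit (↥(maximalRealSubfield L)) L (IsCMField.complexConj L) 2).IsAutomorphicMeasure μ]
    (νG : Measure (quasiSplit (↥(maximalRealSubfield L)) L (IsCMField.complexConj L) 2).Adelic) [νG.IsHaarMeasure]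
    (ρ : Measure ↥(torusAdelic (↥(maximalRealSubfield L)) L (IsCMField.complexConj L) 2)) [ρ.IsHaarMeasure] [ρ.IsInvInvariant]
    (ν : Measure (adelicUnipotent (↥(maximalRealSubfield L)) L (IsCMField.complexConj L) 2)) [ν.IsHaarMeasure]
    (𝓕 : Set (adelicUnipotent (↥(maximalRealSubfield L)) L (IsCMField.complexConj L) 2))
    (h𝓕 : IsFundamentalDomain (rationalUnipotent (↥(maximalRealSubfield L)) L (IsCMField.complexConj L) 2) 𝓕 ν)
    {a : Lˣ} (ha : (IsCMField.complexConj L) (a : L) * (a : L) ≠ 1)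
    {g₀ w : (quasiSplit (↥(maximalRealSubfield L)) L (IsCMField.complexConj L) 2).Rational}
    (hg₀ : ((g₀.1 : GL (Fin 2) L) : Matrix (Fin 2) (Fin 2) L) = !![(a : L), 0; 0, ((IsCMField.complexConj L) (a : L))⁻¹])
    (hw : ((w.1 : GL (Fin 2) L) : Matrix (Fin 2) (Fin 2) L) = !![(0 : L), 1; 1, 0])
    {f : (quasiSplit (↥(maximalRealSubfield L)) L (IsCMField.complexConj L) 2).Adelic → ℂ}
    (hf : IsQuasiSplitTest (↥(maximalRealSubfield L)) L (IsCMField.complexConj L) 2 f)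
    {Cw : ℝ≥0∞} (hC : Cw ≠ ⊤)
    (hwin : ∀ β' : torusInBorel (↥(maximalRealSubfield L)) L (IsCMField.complexConj L) 2 → ℝ≥0∞,
        IsCoveringWeight ((rationalBorel (↥(maximalRealSubfield L)) L (IsCMField.complexConj L) 2).subgroupOf
          (torusInBorel (↥(maximalRealSubfield L)) L (IsCMField.complexConj L) 2)) β' →
        ∀ A B : ℝ≥0, 0 < A → A ≤ B →
          ∫⁻ s : torusInBorel (↥(maximalRealSubfield L)) L (IsCMField.complexConj L) 2, β' s *
            {s : torusInBorel (↥(maximalRealSubfield L)) L (IsCMField.complexConj L) 2 |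
              A < borelHeight (((s : torusInBorel (↥(maximalRealSubfield L)) L (IsCMField.complexConj L) 2) :
                borelAdelic (↥(maximalRealSubfield L)) L (IsCMField.complexConj L) 2) :
                (quasiSplit (↥(maximalRealSubfield L)) L (IsCMField.complexConj L) 2).Adelic) ∧
              borelHeight (((s : torusInBorel (↥(maximalRealSubfield L)) L (IsCMField.complexConj L) 2) :
                borelAdelic (↥(maximalRealSubfield L)) L (IsCMField.complexConj L) 2) :
                (quasiSplit (↥(maximalRealSubfield L)) L (IsCMField.complexConj L) 2).Adelic) ≤ B}.indicator 1 s
            ∂(Measure.map (⇑(Subgroup.subgroupOfEquivOfLe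
              (torusAdelic_le_borelAdelic (F := ↥(maximalRealSubfield L)) (E := L) (c := IsCMField.complexConj L) (N := 2))).symm) ρ :
                Measure (torusInBorel (↥(maximalRealSubfield L)) L (IsCMField.complexConj L) 2)) =
            Cw * ENNReal.ofReal (Real.log (B : ℝ) - Real.log (A : ℝ))) :
    haveI := t2Space_quasiSplitAdelic (F := ↥(maximalRealSubfield L)) (E := L) (c := IsCMField.complexConj L) (N := 2)
    haveI := locallyCompactSpace_quasiSplitAdelic (F := ↥(maximalRealSubfield L)) (E := L) (c := IsCMField.complexConj L) (N := 2)
    haveI := secondCountableTopology_quasiSplitAdelic (F := ↥(maximalRealSubfield L)) (E := L) (c := IsCMField.complexConj L) (N := 2)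
    haveI : DiscreteTopology (quasiSplit (↥(maximalRealSubfield L)) L (IsCMField.complexConj L) 2).quotientSubgroup := by
      rw [quotientSubgroup_quasiSplit]; exact isDiscreteRational_quasiSplit
    haveI : νG.IsMulRightInvariant := isMulRightInvariant_quasiSplit_cm_two L νG
    letI := AdelicGroupData.measurableSpaceQuotientForm (quasiSplit (↥(maximalRealSubfield L)) L (IsCMField.complexConj L) 2)
    haveI := AdelicGroupData.borelSpaceQuotientForm (quasiSplit (↥(maximalRealSubfield L)) L (IsCMField.complexConj L) 2)
    haveI := AdelicGroupData.smulInvariantMeasureQuotientForm (quasiSplit (↥(maximalRealSubfield L)) L (IsCMField.complexConj L) 2) μ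
    haveI := AdelicGroupData.isFiniteMeasureOnCompactsQuotientForm (quasiSplit (↥(maximalRealSubfield L)) L (IsCMField.complexConj L) 2) μ
    ∃ T₀ : ℝ≥0, ∀ T : ℝ≥0, T₀ < T →
        truncatedTraceClass μ ν 𝓕 T
            (fun γ : (quasiSplit (↥(maximalRealSubfield L)) L (IsCMField.complexConj L) 2).arithmeticSubgroup =>
              (((adelicVal (↥(maximalRealSubfield L)) L (IsCMField.complexConj L) 2 _
                  (γ : (quasiSplit (↥(maximalRealSubfield L)) L (IsCMField.complexConj L) 2).Adelic) :
                  GL (Fin 2) (AdeleRing (𝓞 L) L)) : Matrix (Fin 2) (Fin 2) (AdeleRing (𝓞 L) L)).charpoly,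
                decide (∃ δ : (quasiSplit (↥(maximalRealSubfield L)) L (IsCMField.complexConj L) 2).arithmeticSubgroup,
                  δ * γ * δ⁻¹ ∈ arithmeticBorel (↥(maximalRealSubfield L)) L (IsCMField.complexConj L) 2)))
            (((X - C (a : L)) * (X - C ((IsCMField.complexConj L) (a : L))⁻¹)).map
              (algebraMap L (AdeleRing (𝓞 L) L)), true) f =
          ((unfoldingConstant (quasiSplit (↥(maximalRealSubfield L)) L (IsCMField.complexConj L) 2).quotientSubgroup
              (count : Measure (quasiSplit (↥(maximalRealSubfield L)) L (IsCMField.complexConj L) 2).quotientSubgroup) μ νG : ℝ) : ℂ) *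
            ((Cw.toReal : ℂ) * ∫ x : (quasiSplit (↥(maximalRealSubfield L)) L (IsCMField.complexConj L) 2).Adelic ⧸
                torusAdelic (↥(maximalRealSubfield L)) L (IsCMField.complexConj L) 2,
              f ((x.out : (quasiSplit (↥(maximalRealSubfield L)) L (IsCMField.complexConj L) 2).Adelic) *
                  (quasiSplit (↥(maximalRealSubfield L)) L (IsCMField.complexConj L) 2).toAdelic g₀ *
                  (x.out : (quasiSplit (↥(maximalRealSubfield L)) L (IsCMField.complexConj L) 2).Adelic)⁻¹) *
                ((2 * Real.log (T : ℝ) -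
                  Real.log (borelHeight (x.out : (quasiSplit (↥(maximalRealSubfield L)) L (IsCMField.complexConj L) 2).Adelic)⁻¹ : ℝ) -
                  Real.log (borelHeight ((quasiSplit (↥(maximalRealSubfield L)) L (IsCMField.complexConj L) 2).toAdelic w *
                    (x.out : (quasiSplit (↥(maximalRealSubfield L)) L (IsCMField.complexConj L) 2).Adelic)⁻¹) : ℝ) : ℝ) : ℂ)
              ∂(quotientMeasure (torusAdelic (↥(maximalRealSubfield L)) L (IsCMField.complexConj L) 2) ρ isClosed_torusAdelic νG)) := by
  haveI := t2Space_quasiSplitAdelic (F := ↥(maximalRealSubfield L)) (E := L) (c := IsCMField.complexConj L) (N := 2)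
  haveI := locallyCompactSpace_quasiSplitAdelic (F := ↥(maximalRealSubfield L)) (E := L) (c := IsCMField.complexConj L) (N := 2)
  haveI := secondCountableTopology_quasiSplitAdelic (F := ↥(maximalRealSubfield L)) (E := L) (c := IsCMField.complexConj L) (N := 2)
  have hc : IsCMField.complexConj L * IsCMField.complexConj L = 1 := complexConj_mul_complexConj L
  haveI : νG.IsMulRightInvariant := isMulRightInvariant_quasiSplit_cm_two L νG
  haveI : νG.IsInvInvariant := isInvInvariant_of_isMulRightInvariant νG
  -- a section of the fibre and a covering weight of the rational centraliser
  obtain ⟨sec, hsec⟩ := exists_section_borelRefine_hyperbolic_two (F := ↥(maximalRealSubfield L)) hc ha hg₀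
  obtain ⟨β, hβ⟩ := exists_isCoveringWeight_subgroup_map (F := ↥(maximalRealSubfield L)) (E := L)
    (c := IsCMField.complexConj L) (N := 2)
    (Subgroup.centralizer {(⟨(quasiSplit (↥(maximalRealSubfield L)) L (IsCMField.complexConj L) 2).toAdelic g₀, g₀, rfl⟩ :
      (quasiSplit (↥(maximalRealSubfield L)) L (IsCMField.complexConj L) 2).arithmeticSubgroup)})
  have hβm : Measurable β := hβ.measurable
  -- the cusp threshold: integrability AND vanishing of the descended remainder (`i♯` is `N`-regular on `B(F)`)
  obtain ⟨T₁, h1T₁, hT₁⟩ := integral_quotFun_pseudoEisenstein_indicator_eq_zero_cm_two L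
    (isConjInvariant_borelRefine isConjInvariant_charpoly_adelicVal)
    (isUnipotentInvariantOnBorel_borelRefine isUnipotentInvariantOnBorel_charpoly_adelicVal)
    ((((X - C (a : L)) * (X - C ((IsCMField.complexConj L) (a : L))⁻¹)).map
      (algebraMap L (AdeleRing (𝓞 L) L)), true))
    (forall_diagUnit_ne_of_borelRefine_eq_hyperbolic_two hc ha) ν 𝓕 h𝓕 μ f hf
  refine ⟨T₁, fun T hT => ?_⟩
  obtain ⟨-, hR, hR0, -⟩ := hT₁ T hT
  have h1T : 1 ≤ T := (h1T₁.trans_lt hT).le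
  -- compact support of the orbit of `γ♯` modulo `T(𝔸)`: the weighted orbital majorant is finite
  have hint := lintegral_enorm_conj_out_mul_arthurWeight_lt_top_hyperbolic_two ha hg₀ hw (2 * Real.log (T : ℝ))
    hf.continuous' hf.hasCompactSupport'
    (quotientMeasure (torusAdelic (↥(maximalRealSubfield L)) L (IsCMField.complexConj L) 2) ρ isClosed_torusAdelic νG)
  rw [truncatedTraceClass_borelRefine_hyperbolic_eq_mul_mul_integral_quotient_sub_integral_two hc ha hg₀ hw μ νG ρ ν 𝓕
    h1T sec hsec hf.hasCompactSupport' hf.continuous'.measurable hβm hβ hC hwin hint hR, hR0, sub_zero]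

/-- **THE HYPERBOLIC TERM OF THE COARSE GEOMETRIC EXPANSION — ROGAWSKI'S (6.1.3)** for the quasi-split `U(J₃)` of a
CM extension `L/L⁺`: for the refined regular hyperbolic class `i♯` of `cl♭` (`c a · a ≠ 1`, `c b · b = 1`,
`γ♯ = d(a, b, (c a)⁻¹) ⊗ 1`), a test function `f`, an automorphic measure `μ`, Haar measures `ν_G`, `ρ`, `ν` of `G(𝔸)`,
`T(𝔸)`, `N(𝔸)` and a fundamental domain `𝓕` of `N(F)`: there are the rank-one window constant `C_w ≠ ∞` of `ρ`
(with its window law) and `T₀` such that for all `T > T₀`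
`J^T_{i♯}(f) = c_μ · C_w · ∫_{G(𝔸) ⧸ T(𝔸)} f(x̃ γ♯ x̃⁻¹)·(2 log T − log H(x̃⁻¹) − log H(w x̃⁻¹)) d(ν_G/ρ)(x)`.
[cite: Rogawski1990, §6.1 (6.1.1)–(6.1.3)] [cite: Arthur1978TraceFormulaI, §8] -/
theorem truncatedTraceClass_borelRefine_hyperbolic_cm_two (L : Type) [Field L] [NumberField L] [IsCMField L]
    [MeasurableSpace (adelicUnipotent (↥(maximalRealSubfield L)) L (IsCMField.complexConj L) 2)]
    [BorelSpace (adelicUnipotent (↥(maximalRealSubfield L)) L (IsCMField.complexConj L) 2)]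
    [MeasurableSpace (quasiSplit (↥(maximalRealSubfield L)) L (IsCMField.complexConj L) 2).Adelic]
    [BorelSpace (quasiSplit (↥(maximalRealSubfield L)) L (IsCMField.complexConj L) 2).Adelic]
    [MeasurableSpace ((quasiSplit (↥(maximalRealSubfield L)) L (IsCMField.complexConj L) 2).Adelic ⧸
      torusAdelic (↥(maximalRealSubfield L)) L (IsCMField.complexConj L) 2)]
    [BorelSpace ((quasiSplit (↥(maximalRealSubfield L)) L (IsCMField.complexConj L) 2).Adelic ⧸
      torusAdelic (↥(maximalRealSubfield L)) L (IsCMField.complexConj L) 2)]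
    (μ : Measure (quasiSplit (↥(maximalRealSubfield L)) L (IsCMField.complexConj L) 2).automorphicQuotient)
    [(quasiSplit (↥(maximalRealSubfield L)) L (IsCMField.complexConj L) 2).IsAutomorphicMeasure μ]
    (νG : Measure (quasiSplit (↥(maximalRealSubfield L)) L (IsCMField.complexConj L) 2).Adelic) [νG.IsHaarMeasure]
    (ρ : Measure ↥(torusAdelic (↥(maximalRealSubfield L)) L (IsCMField.complexConj L) 2)) [ρ.IsHaarMeasure] [ρ.IsInvInvariant]
    (ν : Measure (adelicUnipotent (↥(maximalRealSubfield L)) L (IsCMField.complexConj L) 2)) [ν.IsHaarMeasure]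
    (𝓕 : Set (adelicUnipotent (↥(maximalRealSubfield L)) L (IsCMField.complexConj L) 2))
    (h𝓕 : IsFundamentalDomain (rationalUnipotent (↥(maximalRealSubfield L)) L (IsCMField.complexConj L) 2) 𝓕 ν)
    {a : Lˣ} (ha : (IsCMField.complexConj L) (a : L) * (a : L) ≠ 1)
    {g₀ w : (quasiSplit (↥(maximalRealSubfield L)) L (IsCMField.complexConj L) 2).Rational}
    (hg₀ : ((g₀.1 : GL (Fin 2) L) : Matrix (Fin 2) (Fin 2) L) = !![(a : L), 0; 0, ((IsCMField.complexConj L) (a : L))⁻¹])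
    (hw : ((w.1 : GL (Fin 2) L) : Matrix (Fin 2) (Fin 2) L) = !![(0 : L), 1; 1, 0])
    {f : (quasiSplit (↥(maximalRealSubfield L)) L (IsCMField.complexConj L) 2).Adelic → ℂ}
    (hf : IsQuasiSplitTest (↥(maximalRealSubfield L)) L (IsCMField.complexConj L) 2 f) :
    haveI := t2Space_quasiSplitAdelic (F := ↥(maximalRealSubfield L)) (E := L) (c := IsCMField.complexConj L) (N := 2)
    haveI := locallyCompactSpace_quasiSplitAdelic (F := ↥(maximalRealSubfield L)) (E := L) (c := IsCMField.complexConj L) (N := 2)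
    haveI := secondCountableTopology_quasiSplitAdelic (F := ↥(maximalRealSubfield L)) (E := L) (c := IsCMField.complexConj L) (N := 2)
    haveI : DiscreteTopology (quasiSplit (↥(maximalRealSubfield L)) L (IsCMField.complexConj L) 2).quotientSubgroup := by
      rw [quotientSubgroup_quasiSplit]; exact isDiscreteRational_quasiSplit
    haveI : νG.IsMulRightInvariant := isMulRightInvariant_quasiSplit_cm_two L νG
    letI := AdelicGroupData.measurableSpaceQuotientForm (quasiSplit (↥(maximalRealSubfield L)) L (IsCMField.complexConj L) 2)
    haveI := AdelicGroupData.borelSpaceQuotientForm (quasiSplit (↥(maximalRealSubfield L)) L (IsCMField.complexConj L) 2)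
    haveI := AdelicGroupData.smulInvariantMeasureQuotientForm (quasiSplit (↥(maximalRealSubfield L)) L (IsCMField.complexConj L) 2) μ
    haveI := AdelicGroupData.isFiniteMeasureOnCompactsQuotientForm (quasiSplit (↥(maximalRealSubfield L)) L (IsCMField.complexConj L) 2) μ
    ∃ Cw : ℝ≥0∞, Cw ≠ ⊤ ∧
      (∀ β' : torusInBorel (↥(maximalRealSubfield L)) L (IsCMField.complexConj L) 2 → ℝ≥0∞,
        IsCoveringWeight ((rationalBorel (↥(maximalRealSubfield L)) L (IsCMField.complexConj L) 2).subgroupOf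
          (torusInBorel (↥(maximalRealSubfield L)) L (IsCMField.complexConj L) 2)) β' →
        ∀ A B : ℝ≥0, 0 < A → A ≤ B →
          ∫⁻ s : torusInBorel (↥(maximalRealSubfield L)) L (IsCMField.complexConj L) 2, β' s *
            {s : torusInBorel (↥(maximalRealSubfield L)) L (IsCMField.complexConj L) 2 |
              A < borelHeight (((s : torusInBorel (↥(maximalRealSubfield L)) L (IsCMField.complexConj L) 2) :
                borelAdelic (↥(maximalRealSubfield L)) L (IsCMField.complexConj L) 2) :
                (quasiSplit (↥(maximalRealSubfield L)) L (IsCMField.complexConj L) 2).Adelic) ∧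
              borelHeight (((s : torusInBorel (↥(maximalRealSubfield L)) L (IsCMField.complexConj L) 2) :
                borelAdelic (↥(maximalRealSubfield L)) L (IsCMField.complexConj L) 2) :
                (quasiSplit (↥(maximalRealSubfield L)) L (IsCMField.complexConj L) 2).Adelic) ≤ B}.indicator 1 s
            ∂(Measure.map (⇑(Subgroup.subgroupOfEquivOfLe
              (torusAdelic_le_borelAdelic (F := ↥(maximalRealSubfield L)) (E := L) (c := IsCMField.complexConj L) (N := 2))).symm) ρ :
                Measure (torusInBorel (↥(maximalRealSubfield L)) L (IsCMField.complexConj L) 2)) =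
            Cw * ENNReal.ofReal (Real.log (B : ℝ) - Real.log (A : ℝ))) ∧
      ∃ T₀ : ℝ≥0, ∀ T : ℝ≥0, T₀ < T →
        truncatedTraceClass μ ν 𝓕 T
            (fun γ : (quasiSplit (↥(maximalRealSubfield L)) L (IsCMField.complexConj L) 2).arithmeticSubgroup =>
              (((adelicVal (↥(maximalRealSubfield L)) L (IsCMField.complexConj L) 2 _
                  (γ : (quasiSplit (↥(maximalRealSubfield L)) L (IsCMField.complexConj L) 2).Adelic) :
                  GL (Fin 2) (AdeleRing (𝓞 L) L)) : Matrix (Fin 2) (Fin 2) (AdeleRing (𝓞 L) L)).charpoly,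
                decide (∃ δ : (quasiSplit (↥(maximalRealSubfield L)) L (IsCMField.complexConj L) 2).arithmeticSubgroup,
                  δ * γ * δ⁻¹ ∈ arithmeticBorel (↥(maximalRealSubfield L)) L (IsCMField.complexConj L) 2)))
            (((X - C (a : L)) * (X - C ((IsCMField.complexConj L) (a : L))⁻¹)).map
              (algebraMap L (AdeleRing (𝓞 L) L)), true) f =
          ((unfoldingConstant (quasiSplit (↥(maximalRealSubfield L)) L (IsCMField.complexConj L) 2).quotientSubgroup
              (count : Measure (quasiSplit (↥(maximalRealSubfield L)) L (IsCMField.complexConj L) 2).quotientSubgroup) μ νG : ℝ) : ℂ) *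
            ((Cw.toReal : ℂ) * ∫ x : (quasiSplit (↥(maximalRealSubfield L)) L (IsCMField.complexConj L) 2).Adelic ⧸
                torusAdelic (↥(maximalRealSubfield L)) L (IsCMField.complexConj L) 2,
              f ((x.out : (quasiSplit (↥(maximalRealSubfield L)) L (IsCMField.complexConj L) 2).Adelic) *
                  (quasiSplit (↥(maximalRealSubfield L)) L (IsCMField.complexConj L) 2).toAdelic g₀ *
                  (x.out : (quasiSplit (↥(maximalRealSubfield L)) L (IsCMField.complexConj L) 2).Adelic)⁻¹) *
                ((2 * Real.log (T : ℝ) -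
                  Real.log (borelHeight (x.out : (quasiSplit (↥(maximalRealSubfield L)) L (IsCMField.complexConj L) 2).Adelic)⁻¹ : ℝ) -
                  Real.log (borelHeight ((quasiSplit (↥(maximalRealSubfield L)) L (IsCMField.complexConj L) 2).toAdelic w *
                    (x.out : (quasiSplit (↥(maximalRealSubfield L)) L (IsCMField.complexConj L) 2).Adelic)⁻¹) : ℝ) : ℝ) : ℂ)
              ∂(quotientMeasure (torusAdelic (↥(maximalRealSubfield L)) L (IsCMField.complexConj L) 2) ρ isClosed_torusAdelic νG)) := by
  haveI := t2Space_quasiSplitAdelic (F := ↥(maximalRealSubfield L)) (E := L) (c := IsCMField.complexConj L) (N := 2)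
  haveI := locallyCompactSpace_quasiSplitAdelic (F := ↥(maximalRealSubfield L)) (E := L) (c := IsCMField.complexConj L) (N := 2)
  haveI := secondCountableTopology_quasiSplitAdelic (F := ↥(maximalRealSubfield L)) (E := L) (c := IsCMField.complexConj L) (N := 2)
  have hc : IsCMField.complexConj L * IsCMField.complexConj L = 1 := complexConj_mul_complexConj L
  have hc1 : IsCMField.complexConj L ≠ 1 := IsCMField.complexConj_ne_one L
  have h2 : Module.finrank (↥(maximalRealSubfield L)) L = 2 :=
    Algebra.IsQuadraticExtension.finrank_eq_two (↥(maximalRealSubfield L)) L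
  haveI : νG.IsMulRightInvariant := isMulRightInvariant_quasiSplit_cm_two L νG
  haveI : νG.IsInvInvariant := isInvInvariant_of_isMulRightInvariant νG
  -- a covering weight of the rational centraliser, read on the torus, fixes the window constant of `ρ`
  obtain ⟨β, hβ⟩ := exists_isCoveringWeight_subgroup_map (F := ↥(maximalRealSubfield L)) (E := L)
    (c := IsCMField.complexConj L) (N := 2)
    (Subgroup.centralizer {(⟨(quasiSplit (↥(maximalRealSubfield L)) L (IsCMField.complexConj L) 2).toAdelic g₀, g₀, rfl⟩ :
      (quasiSplit (↥(maximalRealSubfield L)) L (IsCMField.complexConj L) 2).arithmeticSubgroup)})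
  have hγ : (quasiSplit (↥(maximalRealSubfield L)) L (IsCMField.complexConj L) 2).toAdelic g₀ ∈
      torusAdelic (↥(maximalRealSubfield L)) L (IsCMField.complexConj L) 2 :=
    coe_mk_toAdelic_mem_torusAdelic_of_eq_hyperbolicDiagonal_two hg₀
  have hβT := isCoveringWeight_torus_translate_two hβ
    (mem_centralizer_mk_toAdelic_hyperbolic_iff_mem_torusAdelic_two ha hg₀)
  obtain ⟨Cw, hC, hwin, -⟩ := exists_torusFibre_unfolding_two h2 hc hc1 hγ hw νG ρ hβ.measurable hβT
  obtain ⟨T₀, hT₀⟩ := truncatedTraceClass_borelRefine_hyperbolic_cm_of_window_two L μ νG ρ ν 𝓕 h𝓕 ha hg₀ hw hf hC hwin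
  exact ⟨Cw, hC, hwin, T₀, hT₀⟩

end CM

end UnitaryGroup

end Literature.NumberTheory.Automorphic
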